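import Mathlib
import Summits.Ventures.FusionMHD.Models.SAlphaSecondStableS3A575Core0
import HarnessLib

/-!
# STABLE-POINT core at `(3, 23/4)`, piece 11 (`[14, 18]`): kernel-decided Taylor-model leaves ⇒ `F_11 > 0` and `amplitudeResidual 3 (23/4) F_11 F_11″ ≤ 0` on the piece ⇒ `EnergyDominatesOn` for its amplitude phase

LADDER-GRIDFUSION rung F3 («F3.BALLOON-sα-SECOND-STABILITY-S3-A575»: a second point of the SECOND stable region at s = 3, tightening the second-edge bracket to [111/20, 23/4]); gridfusion-model-7 g9, 2026-08-28 (g8's core lane).  Two `decide +kernel` calls (`OpModel.trig.pLeavesCheck`, scale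
`2^60`, Taylor degree 10, 32 leaves of half-width 1/16) and the lane's soundness theorem `OpSem.trig.pos_of_pLeavesCheck`
(Literature/Analysis/ValidatedNumerics/TaylorModelZeroCert); lit-4's `energyDominatesOn_of_amplitude` (BallooningSAlphaStableSide) turns the two
sign facts into energy domination by `amplitudePhase 3 (23/4) F_11 F_11′` on the piece.  MODELLED: `s–α` model; nothing about a device.
No `native_decide`.  Citations: Freidberg 2014 §12.6.2 (12.97) [Freidberg2014]; Makino–Berz 2003 Alg. 2 [MakinoBerz2003]; Hartman 2002 XI.6.2
[Hartman2002].  Everything here is [instance data].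
-/

open Literature.Analysis.ValidatedNumerics Literature.Analysis.ValidatedNumerics.PolyMP
open Literature.Analysis.ValidatedNumerics.NumericsMP Literature.Analysis.ValidatedNumerics.ExpPoly
open Literature.MathematicalPhysics.MHD.Ballooning
open Real Set

namespace Summit.Ventures.FusionMHD.Models

namespace SAlphaSecondStableS3A575

/-- KERNEL CHECK (residual leaves of piece 11). [instance data] -/
theorem ss3575_res11_ok : OpModel.trig.pLeavesCheck ss3575Prm (2 ^ 60) (ss3575Prog J11 (Poly.deriv (Poly.deriv J11))) [] ss3575Leaves11 = true := by
  decide +kernel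

/-- KERNEL CHECK (positivity leaves of piece 11). [instance data] -/
theorem ss3575_pos11_ok : OpModel.trig.pLeavesCheck ss3575Prm (2 ^ 60) (ss3575PosProg J11) [] ss3575Leaves11 = true := by
  decide +kernel

/-- The leaves tile `[14, 18]`. [instance data] -/
theorem ss3575_tiles11 : tiles (14 : ℚ) (ss3575Leaves11.map fun l => (l.e, l.k)) (18 : ℚ) = true := by
  decide +kernel

/-- **PIECE 11**: the phase of `F_11` dominates the `s–α` energy on `[14, 18]` at `(s, α) = (3, 23/4)`. [instance data] -/
theorem ss3575_dominates11 :
    SAlpha.EnergyDominatesOn 3 (23 / 4) (SAlpha.amplitudePhase 3 (23 / 4) (Poly.eval J11) (Poly.eval (Poly.deriv J11)))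
      (Icc (14 : ℝ) (18 : ℝ)) := by
  have h := ss3575_dominates (lf := J11) (x := 14) (y := 18) (by norm_num) ss3575_tiles11 ss3575_res11_ok ss3575_pos11_ok
  norm_num at h
  exact h

end SAlphaSecondStableS3A575

end Summit.Ventures.FusionMHD.Models
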